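import Literature.AlgebraicGeometry.HodgeTheory.WeilClassesFourfolds
import Literature.AlgebraicGeometry.ComplexMultiplication.ShimuraIsogeny
import Literature.NumberTheory.DiophantineGeometry.AVIsogenyTateHomPoincareProofs
import Literature.AlgebraicGeometry.Motives.AbelianVarietyProjectiveChart
import Literature.AlgebraicGeometry.Motives.VarietiesDimensionProofs
import HarnessLib

/-!
# COR-CM — the Weil fourfold `B ⊞ E` of a CM threefold and a CM elliptic curve: Markman's theorem instantiated

HONEST FRAMING (cell `pub-hodgecm2` / COR-CM, seat b24 gen 8; COUNT-NEUTRAL — no binder row of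
`HOME/BINDER-OWNERS.md` is touched; no case of the Hodge conjecture is proved here: the conclusion is CONDITIONAL on
the displayed named fact `HodgeTheory.Markman2025_weilClasses_algebraic_abelianFourfold`, the B2b-ladder floor R1).
Step L3 (second half) of `HOME/pub-hodgecm2-lit-andre-3/A1-BLUEPRINT.md` for FINDING F-6: the TARGET FOURFOLD
`Y = B ⊞ E` — `B` an abelian threefold, `E` an elliptic curve, with endomorphisms `f`, `g` of square `-d` (for the
A1 line: `f = ι_B(δ_B)`, `g = ι_E(δ_E)` for CM actions and integers `δ² = -d` of the imaginary quadratic field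
`k ⊂ K`, cf. `CyclicSextic.exists_sq_eq_neg_nat_of_isTotallyComplex` / `face_exists_induced_corner` of
`CorCM/CyclicSexticInducedType.lean`) — satisfies the hypotheses of Markman's fourfold theorem:
`dim Y = 2·2` (`AbelianVariety.dim_biprod`), `Y` smooth projective (`AbelianVariety.isSmoothProjective_holds`),
`(f ⊕ g) ≫ (f ⊕ g) = -(d • 𝟙 Y)` (`biprod_map_comp_self_eq_neg`).  Hence (`weilClasses_algebraic_biprod_of_markman`,
CM form `weilClasses_algebraic_cmThreefold_biprod_cmCurve`) every rational `(2,2)` class of `Y` in the Weil plane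
`weilClassesOf Y (f ⊕ g) 2 d` is algebraic, GIVEN Markman's theorem.  THEOREMS ONLY; no `sorry`; axioms
`propext`, `Classical.choice`, `Quot.sound`.  NOT here (steps L4–L6 of the blueprint): the identification of the
face Weil line `W_K(P(f))` with pull-backs of these classes.

## References
* [Markman2025SurveySecant] E. Markman, *Secant sheaves and Weil classes on abelian varieties*, arXiv:2509.23403,
  Thm. 1.2 and §11.5 Step 2 (as vendored in `HodgeTheory/WeilClassesFourfolds.lean`).
* [vanGeemen1994HodgeAV] B. van Geemen, LNM 1594 (1994), 4.9 (the Weil plane `E₊ ⊔ E₋`).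
-/

noncomputable section

namespace Summit.HodgeConjecture.CorCM.WeilFourfold

open CategoryTheory CategoryTheory.Limits NumberField
open Literature.AlgebraicGeometry.Motives Literature.AlgebraicGeometry.HodgeTheory
open Literature.AlgebraicGeometry.ComplexMultiplication (IsCMTypeRealisation)
open Literature.AlgebraicTopology.SingularHomology

/-- `ι(δ) ∘ ι(δ) = -d` for a ring action `ι` and `δ² = -d`. [folklore] -/
theorem comp_self_eq_neg_of_sq_eq_neg {A : AbelianVariety ℂ} {R : Type*} [CommRing R] (ι : R →+* End A)
    {δ : R} {d : ℕ} (hδ : δ ^ 2 = -(d : R)) : ι δ ≫ ι δ = -(d • 𝟙 A) := by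
  rw [← End.mul_def, ← map_mul, ← pow_two, hδ, map_neg, map_natCast, ← Nat.smul_one_eq_cast]
  rfl

/-- `(f ⊕ g)² = -d` on `A ⊞ B` when `f² = -d` and `g² = -d`. [folklore] -/
theorem biprod_map_comp_self_eq_neg {A B : AbelianVariety ℂ} {f : A ⟶ A} {g : B ⟶ B} {d : ℕ}
    (hf : f ≫ f = -(d • 𝟙 A)) (hg : g ≫ g = -(d • 𝟙 B)) :
    biprod.map f g ≫ biprod.map f g = -(d • 𝟙 (A ⊞ B)) := by
  apply biprod.hom_ext
  · rw [Category.assoc, biprod.map_fst, biprod.map_fst_assoc, hf]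
    simp
  · rw [Category.assoc, biprod.map_snd, biprod.map_snd_assoc, hg]
    simp

/-- The dimension of a realisation of a CM type of `K` is `[K:ℚ]/2`. [folklore] -/
theorem dim_eq_of_isCMTypeRealisation {K : Type} [Field K] [NumberField K] {Φ : CMType K}
    {A : AbelianVariety ℂ} {ι : 𝓞 K →+* End A} {θ : K →+* Module.End ℂ (complexBetti A.X 1)}
    (h : IsCMTypeRealisation Φ A ι θ) : A.dim = Module.finrank ℚ K / 2 :=
  schemeDim_eq_holds h.1

/-- **The Markman input on a product fourfold** (cell pub-hodgecm2, A1-BLUEPRINT step L3): for abelian varieties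
`B` of dimension `3` and `E` of dimension `1` with endomorphisms `f`, `g` of square `-d` (`d ≥ 1`), every rational
class of Hodge type `(2,2)` on `Y = B ⊞ E` lying in the Weil plane of `f ⊕ g` is algebraic — Markman's theorem
(named fact `Markman2025_weilClasses_algebraic_abelianFourfold`) instantiated at `(Y, f ⊕ g)`.
[cite: Markman2025SurveySecant, Thm. 1.2 and §11.5 Step 2] -/
theorem weilClasses_algebraic_biprod_of_markman (hW4 : Markman2025_weilClasses_algebraic_abelianFourfold)
    {B E : AbelianVariety ℂ} (hB : B.dim = 3) (hE : E.dim = 1) {f : B ⟶ B} {g : E ⟶ E} {d : ℕ}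
    (hd : 0 < d) (hf : f ≫ f = -(d • 𝟙 B)) (hg : g ≫ g = -(d • 𝟙 E)) :
    ∀ c : singularCohomology ℂ ℂ (ComplexPoints (B ⊞ E).X) (2 * 2), IsRationalClass c →
      IsOfHodgeType (2 * 2) (B ⊞ E).X (2 * 2) 2 2 c → c ∈ weilClassesOf (B ⊞ E) (biprod.map f g) 2 d →
        c ∈ algebraicClasses (B ⊞ E).X 2 := by
  have hdim : (B ⊞ E).dim = 2 * 2 := by rw [AbelianVariety.dim_biprod, hB, hE]
  have hsp : IsSmoothProjective (2 * 2) (B ⊞ E).X := by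
    rw [← hdim]; exact AbelianVariety.isSmoothProjective_holds
  exact hW4 d hd (B ⊞ E) (biprod.map f g) hdim hsp (biprod_map_comp_self_eq_neg hf hg)

/-- **CM form** (the shape used by the A1 line): `B` a realisation of a CM type of a SEXTIC field `K`, `E` a
realisation of a CM type of a QUADRATIC field `k`, `δ_B ∈ 𝓞_K`, `δ_E ∈ 𝓞_k` with `δ_B² = -d = δ_E²` (e.g.
`δ_B = ±i(δ_E)` for `i : k → K`, `δ_E` from `CyclicSextic.exists_sq_eq_neg_nat_of_isTotallyComplex`): the rational
`(2,2)` classes in the Weil plane of `ι_B(δ_B) ⊕ ι_E(δ_E)` on `B ⊞ E` are algebraic, given Markman's theorem.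
[cite: Markman2025SurveySecant, Thm. 1.2 and §11.5 Step 2] -/
theorem weilClasses_algebraic_cmThreefold_biprod_cmCurve (hW4 : Markman2025_weilClasses_algebraic_abelianFourfold)
    {K : Type} [Field K] [NumberField K] {k : Type} [Field k] [NumberField k]
    (h6 : Module.finrank ℚ K = 6) (h2 : Module.finrank ℚ k = 2)
    {Ψ : CMType K} {B : AbelianVariety ℂ} {ιB : 𝓞 K →+* End B} {θB : K →+* Module.End ℂ (complexBetti B.X 1)}
    (hB : IsCMTypeRealisation Ψ B ιB θB)
    {Φ₀ : CMType k} {E : AbelianVariety ℂ} {ιE : 𝓞 k →+* End E} {θE : k →+* Module.End ℂ (complexBetti E.X 1)}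
    (hE : IsCMTypeRealisation Φ₀ E ιE θE)
    {δB : 𝓞 K} {δE : 𝓞 k} {d : ℕ} (hd : 0 < d) (hδB : δB ^ 2 = -(d : 𝓞 K)) (hδE : δE ^ 2 = -(d : 𝓞 k)) :
    ∀ c : singularCohomology ℂ ℂ (ComplexPoints (B ⊞ E).X) (2 * 2), IsRationalClass c →
      IsOfHodgeType (2 * 2) (B ⊞ E).X (2 * 2) 2 2 c →
        c ∈ weilClassesOf (B ⊞ E) (biprod.map (ιB δB) (ιE δE)) 2 d → c ∈ algebraicClasses (B ⊞ E).X 2 := by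
  have hB3 : B.dim = 3 := by rw [dim_eq_of_isCMTypeRealisation hB, h6]
  have hE1 : E.dim = 1 := by rw [dim_eq_of_isCMTypeRealisation hE, h2]
  exact weilClasses_algebraic_biprod_of_markman hW4 hB3 hE1 hd (comp_self_eq_neg_of_sq_eq_neg ιB hδB)
    (comp_self_eq_neg_of_sq_eq_neg ιE hδE)

end Summit.HodgeConjecture.CorCM.WeilFourfold

end
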